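import Summits.QuantumFields.YangMills.Theorems.SwapVirialDeficitPeriodicRingMeanActionFixedLLimit
import Summits.QuantumFields.YangMills.Theorems.SwapVirialDeficitSwapRingMeanActionFixedLLimit
import Summits.QuantumFields.YangMills.Theorems.SwapVirialDeficitLogDerivMixture
import Summits.QuantumFields.YangMills.Theorems.VirialFluxGapTwistedEquipartitionTwoSided
import Summits.QuantumFields.YangMills.Theorems.VirialFluxGapSharpTwistedLaplaceProof
import Summits.QuantumFields.YangMills.Theorems.FluxSectorLaplaceFluxSectorSuppression
import HarnessLib

/-!
# The fixed-`L` RELATIVE MEAN-ACTION GAP `−1/2` of LINE g14-B from the TWO principal small-ball LIMITS (σ-glued: exponent `9L⁴−1`, no log; periodic: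
# exponent `9L⁴−3/2`, one log) — the zero-flux sector mixture run at fixed `L`
# (free-hands support of ⟨stmt-QuantumFields-24194⟩ `SwapVirialDeficit.SwapMeanActionGap` / ⟨24196⟩ / ⟨24197⟩; sequel of
# ✓`PeriodicRing.periodicSoftness_fixedL_of_principalLogLimit` (w3 g64, P0) and ✓`SwapRing.swap_stiffness_fixedL_of_principalLimit` (fcl-p3 g45))

fcl-p3 g45's ✓`SwapRing.swap_meanActionGap_fixedL_of_limits` takes the periodic side as a hypothesis on `Z_phys = physTrace`.  The periodic consumer P0
(✓`…PeriodicRingMeanActionFixedLLimit`) delivers it for the SEAM SECTOR `W₀`; this file runs planner ym-idea-4's sector mixture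
(✓`SectorSmooth.logDerivMixture`: `(log Z)′ = Σ_z p_z (log W_z)′`, ✓`twistedEquipartitionLower_of_sharpTwistedLaplace` ∘ ✓`FixSplit.sharpTwistedLaplace_holds`:
twisted sectors obey the lower half of equipartition, ✓`FluxSectorLaplace.fluxSectorSuppression_proof`: `p_z ≤ β^{−a}/8` for `z ≠ 0`) at FIXED `L ≥ L₀(ε)`
— where the windows `L ≤ β^a` hold for all large `β` — exactly as ✓`SectorMixture.toronSoftnessSharp_of_toronTubeVolumeLaw` does on windows:
* §1 `window_of_large` — at fixed `L`, `L ≤ β^a` for `β ≥ L^{1/a}`;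
* §2 ★★ `periodicPhysTraceSoftness_fixedL_of_principalLogLimit` — for every `ε > 0` there is `L₀` such that at every fixed `L ≥ L₀` the principal
  zero-flux LOG-LIMIT (`v > 0`) gives, eventually in `β`, `12βL⁴ − 9L⁴ + 3/2 − ε ≤ β·(log Z_phys)′(β)` — LITERALLY the hypothesis `hper` (at that `ε`) of
  ✓`swap_meanActionGap_fixedL_of_limits`;
* §3 ★★★ `relativeGap_fixedL_of_limits` — for every `ε > 0` there is `L₀` such that at every fixed `L ≥ L₀`: the σ-glued principal LIMIT
  (`μ_L{F^S_{000} ≤ s}/s^{9L⁴−1} → v_S > 0`) AND the periodic principal LOG-LIMIT (`μ_L{F₀ ≤ s}/(s^{9L⁴−3/2} log s⁻¹) → v_P > 0`) give, eventually in `β`,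
  `β·(log Z^S)′(β) − β·(log Z)′(β) ≤ −(1/2 − 2ε)` — the instrument's slope (j320281: `−0.483 ± 0.038`) as a theorem at fixed `L`, modulo the two
  massive-mode rungs (σ: J1–J6, in progress today; periodic: log-shell, OPEN).
HONEST LABEL: fixed-`L` bookkeeping on landed rows; NEITHER principal limit is proved here; `L₀(ε)` comes from the twisted-sector equipartition and flux
suppression windows; ⟨24194⟩ ∕ ⟨24196⟩ ∕ ⟨24197⟩ ∕ ⟨24497⟩ (window-UNIFORM in `L`) stay OPEN; own crux ⟨22884⟩ OPEN (blocked-on ⟨19935⟩); the Yang–Mills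
mass gap is NOT proved; no summit is proved by a line.
Width seat ym-line-sfw-p2-w3 g64 (cell ym-idea-1, free hands), `--supports stmt-QuantumFields-24194`.  THEOREMS ONLY (0 `def`, 0 `sorry`), standard axioms.
References: [cite: Griffiths1964]; [cite: tHooft1979]; [cite: MontvayMunster1994, (3.145)]; [cite: Luscher1983, §2]; [folklore].
-/

set_option autoImplicit false

noncomputable section

open MeasureTheory Set Filter Topology
open scoped BigOperators
open Literature.MathematicalPhysics.QuantumFieldTheory hiding SU2
open Literature.MathematicalPhysics.QuantumLattice

namespace Summit.QuantumFields.YangMills.Theorems.SwapVirialDeficit.PeriodicRing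

open Summit.QuantumFields.YangMills.Theorems.FemtoTransferGap
open Summit.QuantumFields.YangMills.Theorems.FemtoTransferGap.TT
open Summit.QuantumFields.YangMills.Theorems.VirialFluxGap.RingDeficit
open Summit.QuantumFields.YangMills.Theorems.SwapVirialDeficit.SwapRing (swapRingDeficit swap_stiffness_fixedL_of_principalLimit)

/-! ## §1 Windows at fixed `L` -/

/-- At fixed `L`, the Laplace window `L ≤ β^a` (`a > 0`) holds for every `β ≥ L^{1/a}`. [folklore] -/
theorem window_of_large {a : ℝ} (ha : 0 < a) (L : ℕ) {β : ℝ} (hβ : (L : ℝ) ^ (1 / a) ≤ β) : (L : ℝ) ≤ β ^ a := by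
  have hL : (0 : ℝ) ≤ (L : ℝ) := Nat.cast_nonneg L
  have h1 : (0 : ℝ) ≤ (L : ℝ) ^ (1 / a) := Real.rpow_nonneg hL _
  calc (L : ℝ) = ((L : ℝ) ^ (1 / a)) ^ a := by rw [one_div, Real.rpow_inv_rpow hL ha.ne']
    _ ≤ β ^ a := Real.rpow_le_rpow h1 hβ ha.le

/-! ## §2 The zero-flux ring trace at fixed `L` from the principal log-limit (sector mixture) -/

/-- ★★ **FIXED-`L` ∀ε SHARP SOFTNESS OF `Z_phys` FROM THE PERIODIC PRINCIPAL LOG-LIMIT.**  For every `ε > 0` there is `L₀` such that for every fixed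
`L ≥ L₀`: if `μ_L{F₀ ≤ s}/(s^{9L⁴−3/2}·log s⁻¹) → v > 0` as `s → 0⁺`, then for all large `β`,
`12βL⁴ − 9L⁴ + 3/2 − ε ≤ β·(d/dβ) log Z_phys(L, β, 2L)`.  (`W₀`: ✓`periodicSoftness_fixedL_of_principalLogLimit` at `ε/2`; twisted sectors: lower
equipartition `12βL⁴ − 9L⁴ − ε/2` and probability `≤ β^{−a}/8`; mixture ✓`logDerivMixture`.) [cite: Griffiths1964] [cite: tHooft1979] [cite: MontvayMunster1994, (3.145)] -/
theorem periodicPhysTraceSoftness_fixedL_of_principalLogLimit {ε : ℝ} (hε : 0 < ε) :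
    ∃ L₀ : ℕ, ∀ (L : ℕ) [NeZero L], L₀ ≤ L → ∀ {v : ℝ}, 0 < v →
      Tendsto (fun s : ℝ => (ringMeasure L).real {P | ringDeficit L (fun _ => false) P ≤ s} / (s ^ (9 * (L : ℝ) ^ 4 - 3 / 2) * Real.log s⁻¹))
        (𝓝[>] 0) (𝓝 v) →
      ∃ β₀ : ℝ, ∀ β : ℝ, β₀ ≤ β →
        12 * β * (L : ℝ) ^ 4 - 9 * (L : ℝ) ^ 4 + 3 / 2 - ε ≤ β * deriv (fun b : ℝ => Real.log (TT.physTrace L b (2 * L))) β := by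
  have h1 := Summit.QuantumFields.YangMills.Theorems.FemtoTransferGap.TT.SectorSmooth.logDerivMixture
  have h3 := Summit.QuantumFields.YangMills.Theorems.VirialFluxGap.TwistedEquipartitionTwoSided.twistedEquipartitionLower_of_sharpTwistedLaplace
    Summit.QuantumFields.YangMills.Theorems.VirialFluxGap.FixSplit.sharpTwistedLaplace_holds
  have h4 := Summit.QuantumFields.YangMills.Theorems.FluxSectorLaplace.fluxSectorSuppression_proof
  obtain ⟨a₃, ha₃, β₃, L₃, hTw⟩ := h3 (ε / 2) (by linarith)
  obtain ⟨a₄, ha₄, β₄, L₄, hF⟩ := h4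
  refine ⟨max L₃ L₄, fun L _ hL v hv hlim => ?_⟩
  have hL₃ : L₃ ≤ L := le_trans (le_max_left _ _) hL
  have hL₄ : L₄ ≤ L := le_trans (le_max_right _ _) hL
  -- the seam sector at fixed `L`
  obtain ⟨β₂, hP⟩ := periodicSoftness_fixedL_of_principalLogLimit L hv hlim (ε := ε / 2) (by linarith)
  -- `β^{-a₄} → 0`
  have hev : ∀ᶠ β : ℝ in atTop, β ^ (-a₄) < 8 * ε / 21 := by
    have ht : Tendsto (fun β : ℝ => β ^ (-a₄)) atTop (𝓝 0) := tendsto_rpow_neg_atTop ha₄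
    exact ht.eventually (gt_mem_nhds (by linarith))
  obtain ⟨β₅, hβ₅⟩ := Filter.eventually_atTop.mp hev
  refine ⟨max (max (max β₂ β₃) (max β₄ β₅)) (max (max ((L : ℝ) ^ (1 / a₃)) ((L : ℝ) ^ (1 / a₄))) 1), fun β hβ => ?_⟩
  have hβ₂ : β₂ ≤ β := le_trans (le_trans (le_trans (le_max_left _ _) (le_max_left _ _)) (le_max_left _ _)) hβ
  have hβ₃ : β₃ ≤ β := le_trans (le_trans (le_trans (le_max_right _ _) (le_max_left _ _)) (le_max_left _ _)) hβ
  have hβ₄ : β₄ ≤ β := le_trans (le_trans (le_trans (le_max_left _ _) (le_max_right _ _)) (le_max_left _ _)) hβ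
  have hβ₅' : β₅ ≤ β := le_trans (le_trans (le_trans (le_max_right _ _) (le_max_right _ _)) (le_max_left _ _)) hβ
  have hw₃ : (L : ℝ) ^ (1 / a₃) ≤ β := le_trans (le_trans (le_trans (le_max_left _ _) (le_max_left _ _)) (le_max_right _ _)) hβ
  have hw₄ : (L : ℝ) ^ (1 / a₄) ≤ β := le_trans (le_trans (le_trans (le_max_right _ _) (le_max_left _ _)) (le_max_right _ _)) hβ
  have hβ1 : (1 : ℝ) ≤ β := le_trans (le_trans (le_max_right _ _) (le_max_right _ _)) hβ
  have hLa₃ : (L : ℝ) ≤ β ^ a₃ := window_of_large ha₃ L hw₃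
  have hLa₄ : (L : ℝ) ≤ β ^ a₄ := window_of_large ha₄ L hw₄
  have hsmall : β ^ (-a₄) < 8 * ε / 21 := hβ₅ β hβ₅'
  -- the mixture
  obtain ⟨p, hp0, hp1, hpW, hder⟩ := h1 L β
  have hZpos : 0 < TT.physTrace L β (2 * L) :=
    ((Summit.QuantumFields.YangMills.Theorems.swapVirialDeficit_ringTraceSmooth_proof L (2 * L)).2.2 β).1
  set z0 : Fin 3 → Bool := fun _ => false with hz0
  set M : ℝ := 12 * β * (L : ℝ) ^ 4 - 9 * (L : ℝ) ^ 4 with hM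
  set d : (Fin 3 → Bool) → ℝ := fun z =>
    deriv (fun b : ℝ => Real.log (TT.sectorWeight (L := L) b (2 * L - 1) z (fun _ _ => (1 : ℝ)))) β with hd
  -- sector bounds
  have hX0 : M + 3 / 2 - ε / 2 ≤ β * d z0 := by
    have := (hP β hβ₂).1
    simpa [hM, hd, hz0] using this
  have hXz : ∀ z, M - ε / 2 ≤ β * d z := by
    intro z
    by_cases hz : z = z0
    · subst hz; linarith
    · have := hTw β hβ₃ L hL₃ hLa₃ z (by simpa [hz0] using hz)
      simpa [hM, hd] using this
  -- flux suppression ⇒ `p_z ≤ β^{-a₄}/8` for `z ≠ z0`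
  have hpz : ∀ z, z ≠ z0 → p z ≤ β ^ (-a₄) / 8 := by
    intro z hz
    have hWle := hF β hβ₄ L hL₄ hLa₄ z (by simpa [hz0] using hz)
    rw [hpW z] at hWle
    have : p z * 8 ≤ β ^ (-a₄) := by
      have h8Z : 0 < 8 * TT.physTrace L β (2 * L) := by positivity
      nlinarith [hWle, hZpos]
    linarith
  have hcard : (Finset.univ.erase z0).card = 7 := by
    rw [Finset.card_erase_of_mem (Finset.mem_univ _)]
    simp
  have hsum_erase : ∑ z ∈ Finset.univ.erase z0, p z ≤ 7 * (β ^ (-a₄) / 8) := by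
    have := Finset.sum_le_card_nsmul (Finset.univ.erase z0) p (β ^ (-a₄) / 8)
      (fun z hz => hpz z (Finset.ne_of_mem_erase hz))
    rw [hcard] at this
    simpa [nsmul_eq_mul] using this
  have hp0_split : p z0 + ∑ z ∈ Finset.univ.erase z0, p z = 1 := by
    rw [Finset.add_sum_erase _ _ (Finset.mem_univ z0)]; exact hp1
  have hp0_lb : 1 - 7 * (β ^ (-a₄) / 8) ≤ p z0 := by linarith
  -- convex-combination estimate
  have hmain : (M - ε / 2) + 3 / 2 * p z0 ≤ ∑ z, p z * (β * d z) := by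
    have hpt : ∀ z ∈ (Finset.univ : Finset (Fin 3 → Bool)),
        p z * (M - ε / 2) + (if z = z0 then 3 / 2 * p z else 0) ≤ p z * (β * d z) := by
      intro z _
      by_cases hz : z = z0
      · subst hz; simp only [if_true]; nlinarith [hX0, hp0 z0]
      · simp only [hz, if_false]; nlinarith [hXz z, hp0 z]
    have hS := Finset.sum_le_sum hpt
    rw [Finset.sum_add_distrib, Finset.sum_ite_eq' Finset.univ z0, if_pos (Finset.mem_univ _), ← Finset.sum_mul, hp1,
      one_mul] at hS
    exact hS
  have hrew : β * deriv (fun b : ℝ => Real.log (TT.physTrace L b (2 * L))) β = ∑ z, p z * (β * d z) := by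
    rw [hder, Finset.mul_sum]
    refine Finset.sum_congr rfl fun z _ => ?_
    simp only [hd]; ring
  rw [hrew]
  have hnn : 0 ≤ β ^ (-a₄) := Real.rpow_nonneg (by linarith) _
  nlinarith [hmain, hp0_lb, hsmall, hnn]

/-! ## §3 The fixed-`L` relative gap from the two principal limits -/

/-- ★★★ **THE FIXED-`L` RELATIVE GAP `−1/2` OF LINE g14-B, MODULO THE TWO MASSIVE-MODE RUNGS.**  For every `ε > 0` there is `L₀` such that at every
fixed `L ≥ L₀`: if the σ-glued principal small-ball LIMIT holds (`μ_L{F^S_{000} ≤ s}/s^{9L⁴−1} → v_S > 0`) and the periodic principal LOG-LIMIT holds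
(`μ_L{F₀ ≤ s}/(s^{9L⁴−3/2}·log s⁻¹) → v_P > 0`), then for all large `β`
`β·(log Z^S)′(β) − β·(log Z_phys)′(β) ≤ −(1/2 − 2ε)` — the mapping torus of the axis exchange is STIFFER than the periodic femto ring by one half
unit of mean action (one modulus fewer: `9L⁴ − 1` against `9L⁴ − 3/2`), the number instrument j320281 measured (`−0.483 ± 0.038`).
(✓`SwapRing.swap_stiffness_fixedL_of_principalLimit` for the σ side, §2 for the periodic side.) [cite: Griffiths1964] [cite: tHooft1979] [cite: Luscher1983, §2] -/
theorem relativeGap_fixedL_of_limits {ε : ℝ} (hε : 0 < ε) :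
    ∃ L₀ : ℕ, ∀ (L : ℕ) [NeZero L], L₀ ≤ L → ∀ {vS vP : ℝ}, 0 < vS → 0 < vP →
      Tendsto (fun s : ℝ => (ringMeasure L).real {P | swapRingDeficit L (fun _ => false) P ≤ s} / s ^ (9 * L ^ 4 - 1)) (𝓝[>] 0) (𝓝 vS) →
      Tendsto (fun s : ℝ => (ringMeasure L).real {P | ringDeficit L (fun _ => false) P ≤ s} / (s ^ (9 * (L : ℝ) ^ 4 - 3 / 2) * Real.log s⁻¹))
        (𝓝[>] 0) (𝓝 vP) →
      ∃ β₀ : ℝ, ∀ β : ℝ, β₀ ≤ β →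
        β * deriv (fun b : ℝ => Real.log (TT.twistTrace L b (2 * L))) β -
            β * deriv (fun b : ℝ => Real.log (TT.physTrace L b (2 * L))) β ≤ -(1 / 2 - 2 * ε) := by
  obtain ⟨L₀, hper⟩ := periodicPhysTraceSoftness_fixedL_of_principalLogLimit hε
  refine ⟨L₀, fun L _ hL vS vP hvS hvP hS hP => ?_⟩
  obtain ⟨β₃, hβ₃⟩ := swap_stiffness_fixedL_of_principalLimit L hvS hS hε
  obtain ⟨βp, hβp⟩ := hper L hL hvP hP
  refine ⟨max β₃ βp, fun b hb => ?_⟩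
  have h1 := (hβ₃ b (le_trans (le_max_left _ _) hb)).1
  have h2 := hβp b (le_trans (le_max_right _ _) hb)
  linarith

end Summit.QuantumFields.YangMills.Theorems.SwapVirialDeficit.PeriodicRing

end
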